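import Literature.NumberTheory.EllipticCurves.Sprung2017.SharpFlatNonvanishingProofs
import HarnessLib

/-!
# Crux K1 `SprungLowerDivisibilityAtThree` (item stmt-BirchSwinnertonDyer-19875), line `chromatic-common-zeros`:
# the LEVEL-ONE ♯-DOOR for stub S0 `stub_bothColours` — one non-vanishing Birch sum at a conductor-`p²`
# character forces `L♯ ≠ 0`, at ANY analytic rank

Cell `bsd-ssimc` (host) / lead `cruxlead-stmt-BirchSwinnertonDyer-19875`, width seat w3; `--supports` 19875 (helper);
theorems only; closes NO item; K1 / S0 / BSD / leaf X8 are NOT proved by anything here.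

## The observation

The tree's Sprung pair is characterised by the Mazur–Tate congruences
`θ_n ≡ −(u_n · L♯ + v_n · L♭) (mod ω_n)` at EVERY level `n` (`Sprung2017.IsSprungPair`; `u_n = sharpPoly`,
`v_n = flatPoly`). At a character of conductor `p^{n+e₀}`, `n ≥ 2`, the interpolated value is a genuinely MIXED
combination of `L♯(ζ−1)` and `L♭(ζ−1)` when `a_p ≠ 0` (both `u_n(ζ−1)`, `v_n(ζ−1)` are non-zero), which is why
Rohrlich's theorem yields only `(L♯, L♭) ≠ (0,0)` (`IsSprungPair.ne_zero_or_ne_zero`, Sprung 2012 Prop. 6.14) and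
not the conjectured `L♯ ≠ 0 ∧ L♭ ≠ 0` (stub S0; Sprung 2017, question after Cor. 4.11). But AT LEVEL ONE the
combination is a coordinate axis for every `a_p`: `u_1 = 1`, `v_1 = 0` (`sharpPoly_one`, `flatPoly_one`), i.e.
`θ_1 ≡ −L♯ (mod ω_1)`. Evaluating at `ζ − 1`, `ζ = χ(γ)` for an even `p`-power-order character `χ` modulo
`p^{1+e₀}` (`IsCongrModOmega.eval₂_eq`, `eval₂_mazurTateElement_eq_ratTwistedSymbolSum`):

  `L♯ = 0 ⟹ ∑_{a mod p^{1+e₀}} χ(a) · [a/p^{1+e₀}]⁺_f = 0` for every such `χ`.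

Contrapositive (`sharp_ne_zero_of_ratTwistedSymbolSum_ne_zero`): ONE non-vanishing Birch sum at a character of
conductor dividing `p^{1+e₀}` — for class X8 (`p = 3`): a cubic character of conductor `9`, a sum of six modular
symbols `[a/9]⁺_f` — certifies `L♯ ≠ 0`, whatever the analytic rank. (By Birch's formula the sum is
`τ(χ)·L(E, χ̄, 1)/Ω⁺_f`; the trivial character recovers the known `L(E,1) ≠ 0 ⟹ L♯ ≠ 0`.) This is a per-pair
finite certificate for the ♯-half of stub S0 at `r_an ≥ 1`, where the tree had nothing; the ♭-half has no
level at which it is seen alone except `T = 0` (value `c_♭ · L(E,1)/Ω⁺_f`), so it stays with Sprung's question.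

## Contents
* §1 `isCongrModOmega_one_zero_of_sharp_eq_zero` — `L♯ = 0 ⟹ θ_1 ≡ 0 (mod ω_1)` in `Λ ⊗ ℚ_p`.
* §2 `ratTwistedSymbolSum_eq_zero_of_sharp_eq_zero`, `sharp_ne_zero_of_ratTwistedSymbolSum_ne_zero` — general
  `p`, any level-`N` form `f`, any `a` (no curve, no parity, no supersingularity hypothesis).
(No X8-specialised restatement is given: the door needs none of `ClassX8`, `IsNewformOf`, `r_an`; the lead's
composition consumes it per pair through stub S0's ♯ conjunct.)

References: [Sprung2017] Cor. 4.4–4.5, Thm. 1.12, Cor. 4.11 and the question after it; [Sprung2012] Prop. 6.14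
(p. 1498); [Pollack2003] Prop. 6.9 (proof), Def. 6.15; [MazurTateTeitelbaum1986Invent] §I.8 (8.6), §I.13.
-/

set_option linter.dupNamespace false
set_option autoImplicit false

noncomputable section

open scoped MatrixGroups ModularForm

open CongruenceSubgroup Polynomial Literature.NumberTheory.EllipticCurves
  Literature.NumberTheory.EllipticCurves.ModularForms Literature.NumberTheory.EllipticCurves.Sprung2017

namespace Summit.BirchSwinnertonDyer.BirchSwinnertonDyer.Theorems.ChromaticCommonZerosSharpDoor

section General

variable {N : ℕ} [NeZero N] {f : CuspForm (Gamma0 N) 2} {p : ℕ} [Fact p.Prime]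

/-! ### §1 `L♯ = 0` kills `θ_1` modulo `ω_1` -/

omit [NeZero N] in
/-- **Level one of the Mazur–Tate characterisation is the ♯-axis**: for a Sprung pair `(L♯, L♭)` of `(f, p, a)`
with `L♯ = 0`, `θ_1 ≡ −(u_1·0 + v_1·L♭) = 0 (mod ω_1)` in `Λ ⊗ ℚ_p`, because `u_1 = 1`, `v_1 = 0`
(`sharpPoly_one`, `flatPoly_one`). [cite: Sprung2017, Cor. 4.4 and Cor. 4.5 (level 1)] -/
theorem isCongrModOmega_one_zero_of_sharp_eq_zero {a : ℤ} {Lsharp Lflat : IwasawaAlgebra p}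
    (hSP : IsSprungPair f p a Lsharp Lflat) (h0 : Lsharp = 0) :
    IsCongrModOmega p 1 (mazurTateElement f p 1) (-1) 0 := by
  have h1 := hSP 1
  rwa [sharpPoly_one, flatPoly_one, h0, map_one, map_zero, mul_zero, zero_mul, add_zero] at h1

/-! ### §2 The Birch sums at conductor `p^{1+e₀}` vanish when `L♯ = 0`; contrapositive -/

omit [NeZero N] in
/-- **`L♯ = 0` forces every Birch sum at a conductor-`p^{1+e₀}` character to vanish.** For a Sprung pair
`(L♯, L♭)` of `(f, p, a)` with `L♯ = 0` and every Dirichlet character `χ` modulo `p^{1+e₀}` with values in `ℂ_p`,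
even and of `p`-power order (a character of `Γ/Γ^{p}`), `∑_{a mod p^{1+e₀}} χ(a)·[a/p^{1+e₀}]⁺_f = 0`: evaluate
`θ_1 ≡ 0 (mod ω_1)` at `χ(γ) − 1` (`IsCongrModOmega.eval₂_eq`; `(χ(γ))^{p} = 1`, `orderOf_cyclotomicGenerator`) and
read `θ_1(χ(γ) − 1)` as the Birch sum (`eval₂_mazurTateElement_eq_ratTwistedSymbolSum`). No hypothesis on `a`,
`f` or parity. [cite: Sprung2017, Cor. 4.5 (level 1)] [cite: Pollack2003, Prop. 6.9 (proof)]
[cite: MazurTateTeitelbaum1986Invent, §I.13] -/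
theorem ratTwistedSymbolSum_eq_zero_of_sharp_eq_zero {a : ℤ} {Lsharp Lflat : IwasawaAlgebra p}
    (hSP : IsSprungPair f p a Lsharp Lflat) (h0 : Lsharp = 0)
    (χ : DirichletCharacter ℂ_[p] (p ^ (1 + cyclotomicExponent p))) (hev : χ.Even)
    (hord : ∃ j : ℕ, orderOf χ = p ^ j) : ratTwistedSymbolSum f χ = 0 := by
  have h := isCongrModOmega_one_zero_of_sharp_eq_zero hSP h0
  set ζ : ℂ_[p] := χ (cyclotomicGenerator p : ZMod (p ^ (1 + cyclotomicExponent p))) with hζ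
  have hpow : ζ ^ p ^ 1 = 1 := by
    rw [hζ, ← map_pow, ← orderOf_cyclotomicGenerator p 1, pow_orderOf_eq_one, map_one]
  have hz : ‖ζ - 1‖ < 1 := norm_sub_one_lt_one_of_pow_prime_pow_eq_one hpow
  have hzn : (1 + (ζ - 1)) ^ p ^ 1 = 1 := by rwa [add_sub_cancel]
  have h1 := h.eval₂_eq hz hzn
  rw [eval₂_mazurTateElement_eq_ratTwistedSymbolSum f χ hev hord] at h1
  rw [h1]
  simp

omit [NeZero N] in
/-- **THE LEVEL-ONE ♯-DOOR**: for a Sprung pair `(L♯, L♭)` of `(f, p, a)`, if ONE Birch sum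
`∑_{a mod p^{1+e₀}} χ(a)·[a/p^{1+e₀}]⁺_f` at an even `p`-power-order character `χ` modulo `p^{1+e₀}` (values in
`ℂ_p`) is non-zero, then `L♯ ≠ 0`. For `p = 3`: a cubic character of conductor `9`, six modular symbols. A
finite per-pair certificate, valid at every analytic rank. [cite: Sprung2017, Cor. 4.5 (level 1) and the question after Cor. 4.11]
[cite: Pollack2003, Prop. 6.9 (proof)] -/
theorem sharp_ne_zero_of_ratTwistedSymbolSum_ne_zero {a : ℤ} {Lsharp Lflat : IwasawaAlgebra p}
    (hSP : IsSprungPair f p a Lsharp Lflat)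
    (χ : DirichletCharacter ℂ_[p] (p ^ (1 + cyclotomicExponent p))) (hev : χ.Even)
    (hord : ∃ j : ℕ, orderOf χ = p ^ j) (hχ : ratTwistedSymbolSum f χ ≠ 0) : Lsharp ≠ 0 :=
  fun h0 ↦ hχ (ratTwistedSymbolSum_eq_zero_of_sharp_eq_zero hSP h0 χ hev hord)

end General

end Summit.BirchSwinnertonDyer.BirchSwinnertonDyer.Theorems.ChromaticCommonZerosSharpDoor

end
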